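import Summits.BirchSwinnertonDyer.BirchSwinnertonDyer.Theorems.OneSidedTwistSqueezeX9KatoDivisibilityX9KolyvaginReciprocityPkDivision
import Summits.BirchSwinnertonDyer.BirchSwinnertonDyer.Theorems.SmallImageMuTransferMuTransferX9LocalTwistOperator
import Literature.NumberTheory.EllipticCurves.IwasawaTwistModPk
import HarnessLib

set_option autoImplicit false

-- the summit and its single problem are both named `BirchSwinnertonDyer` (registry layout D-0017)
set_option linter.dupNamespace false

/-!
# Crux `KatoDivisibilityX9` (stmt-BirchSwinnertonDyer-20547), line `graded_euler_loss`, stub `stub_reciprocityPkAX9`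
# (1c′, hypothesis `hLocalPk`), file A: THE TRANSVERSE VALUE MODULE AT LEVEL `p^k` — `ker ω(S) = (m_ω·ω)(S)·𝒯_J`
# on the coordinate model `𝒯_J = Fin J → M` (`p^k • M = 0`, `M` finite), by division with remainder and counting

Seat `bsd-line-k6-p4` (prover-bsd-line-k6-p4-g6-0, 6th LEAD on the crux).  THEOREMS ONLY (pure algebra on
`Fin J → M` with the shift `S = shiftEnd M J`); no definition, no named fact, no `sorry`; nothing is asserted about
any curve; `--supports stmt-BirchSwinnertonDyer-20547` helper, closes nothing.

WHY.  The level-`p^k` `q`-term identity (`hLocalPk` of `…KolyvaginReciprocityPkOfLocal`) is koly's Lemma 1 (iii)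
(`LocalSplitPrime.exists_unit_inv_cupProduct_eq_sum_convCoeff`) with `twistModP ↦ twistModPk`.  At an `E`-split
Frobenius of depth `m` the local twist `𝒯_J^{(k)}|_q` is acted on by `(1+S)^{p^m u} = 1 + ω(S)·Q(S)`,
`ω = (X+1)^{p^m} − 1`, `Q(0) = u` a unit; so the transverse values `H¹_tr ≅ (𝒯_J|_q)^{Γ_{K_q}}` are `ker ω(S)`.
At level `p` this is `ker S^{p^m} = S^{J−p^m}𝒯_J`; at level `p^k`, `ω` is NOT a unit multiple of a power of `S`,
and the replacement — for the level `J = 2p^m k` of the graded core, where `X^J = m_ω·ω² + p^k·h` in `ℤ[X]`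
(`…KolyvaginReciprocityPkDivision.exists_omega_sq_rel`) — is **`ker ω(S) = (m_ω ω)(S)·𝒯_J`**, proved here:
* §1 `aeval_shiftEnd_single_apply` — coordinates of `F(S)·δ_t c`.
* §2 `exists_aeval_add_eq_of_monic` — DIVISION WITH REMAINDER by a monic `F` on `Fin J → M`: `y = F(S)a + r`
  with `r` supported in degrees `< deg F` (descending elimination, leading coefficient `1`).
* §3 `natCard_ker_aeval_shiftEnd_le_of_monic` — hence `#ker F(S) = #coker F(S) ≤ #M^{deg F}`.
* §4 **`ker_aeval_eq_range_aeval_of_monic_of_rel`** — for monic `ω`, `g` with `deg ω + deg g = J`,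
  `g·ω ≡ X^J (mod p^k)` and `p^k • M = 0`: `ker ω(S) = range g(S)` (⊇ by `g ω ≡ X^J`; the cardinalities
  `#ker ω(S) ≤ #M^{deg ω} ≤ #range g(S)` close it).  With `g = m_ω·ω` this is the transverse value module.
* §5 units: `isUnit_natCast_end_of_coprime` (a natural number prime to `p` acts invertibly when `p^k • M = 0`),
  `isUnit_aeval_of_isUnit_coeff_zero` (`Q(S)` is a unit when `Q(0)` acts invertibly: `Q(S) = Q(0) + S·(…)`, `S`
  nilpotent), `ker_comp_eq_of_isUnit` / `range_comp_eq_of_isUnit` bookkeeping.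

References: L. Washington, GTM 83, §7.1–§7.2 (division by distinguished polynomials in `Λ/(p^k)`), §13.1–13.2
[Washington1997]; B. Mazur, K. Rubin, Mem. AMS 799 (2004) Lemma 1.2.1, §5.3 [MazurRubin2004]; HOME/MEMO-es.md §15.
-/

noncomputable section

open Polynomial Finset
open Literature.NumberTheory.GaloisRepresentations
open Literature.NumberTheory.EllipticCurves
open Summit.BirchSwinnertonDyer.BirchSwinnertonDyer.Theorems.OneSidedTwistSqueezeX9KatoDivisibilityX9StubReciprocityPkX9Transfer

namespace Summit.BirchSwinnertonDyer.BirchSwinnertonDyer.Theorems.OneSidedTwistSqueezeX9KatoDivisibilityX9ReciprocityPkAnnihilator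

/-! ## §1 Coordinates of `F(S)·δ_t c` -/

section Single

variable {M : Type*} [AddCommGroup M] {J : ℕ}

/-- `(S^n δ_t c)_j = c` if `j = t + n`, else `0`. [cite: Washington1997, §13.1–§13.2] -/
theorem shiftEnd_pow_single_apply (n : ℕ) (t j : Fin J) (c : M) :
    (shiftEnd M J ^ n) (Pi.single t c) j = if (j : ℕ) = t + n then c else 0 := by
  rw [shiftEnd_pow_apply]
  by_cases h : (j : ℕ) < n
  · rw [dif_pos h, if_neg (by omega)]
  · rw [dif_neg h]
    by_cases hjt : (j : ℕ) = t + n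
    · rw [if_pos hjt]
      have : (⟨(j : ℕ) - n, by omega⟩ : Fin J) = t := Fin.ext (by simp; omega)
      rw [this, Pi.single_eq_same]
    · rw [if_neg hjt, Pi.single_eq_of_ne]
      exact fun heq => hjt (by have := congrArg Fin.val heq; simp at this; omega)

/-- **Coordinates of `F(S)·δ_t c`**: `(F(S) δ_t c)_j = F_{j−t}·c` for `j ≥ t` and `0` for `j < t`.
[cite: Washington1997, §13.1–§13.2] -/
theorem aeval_shiftEnd_single_apply (F : ℤ[X]) (t j : Fin J) (c : M) :
    aeval (shiftEnd M J) F (Pi.single t c) j = if (t : ℕ) ≤ j then F.coeff (j - t) • c else 0 := by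
  rw [aeval_eq_sum_range, LinearMap.coe_sum, Finset.sum_apply, Finset.sum_apply]
  simp only [LinearMap.smul_apply, Pi.smul_apply, shiftEnd_pow_single_apply, smul_ite, smul_zero]
  by_cases htj : (t : ℕ) ≤ j
  · rw [if_pos htj, Finset.sum_ite, Finset.sum_const_zero, add_zero]
    have hfilter : (range (F.natDegree + 1)).filter (fun n => (j : ℕ) = t + n) =
        if (j : ℕ) - t < F.natDegree + 1 then {(j : ℕ) - t} else ∅ := by
      ext n
      simp only [mem_filter, mem_range]
      split_ifs with h
      · simp only [mem_singleton]; omega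
      · simp only [Finset.notMem_empty, iff_false, not_and]; omega
    rw [hfilter]
    split_ifs with h
    · rw [sum_singleton]
    · rw [sum_empty, coeff_eq_zero_of_natDegree_lt (by omega), zero_smul]
  · rw [if_neg htj]
    exact Finset.sum_eq_zero fun n _ => if_neg (by omega)

end Single

/-! ## §2 Division with remainder by a monic polynomial on `Fin J → M` -/

section Division

variable {M : Type*} [AddCommGroup M] {J : ℕ} {F : ℤ[X]}

/-- Descending elimination: after `n` steps the top `n` coordinates of index `≥ deg F` of `y − F(S)a` vanish.
[cite: Washington1997, §7.1–§7.2] -/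
theorem exists_aeval_sub_apply_eq_zero_of_monic (hF : F.Monic) (y : Fin J → M) (n : ℕ) :
    ∃ a : Fin J → M, ∀ j : Fin J, F.natDegree ≤ (j : ℕ) → J ≤ (j : ℕ) + n →
      (y - aeval (shiftEnd M J) F a) j = 0 := by
  induction n with
  | zero => exact ⟨0, fun j _ h => absurd j.2 (by omega)⟩
  | succ n ih =>
    obtain ⟨a, ha⟩ := ih
    by_cases hcase : F.natDegree + n + 1 ≤ J
    · -- the new coordinate `j₀ = J − n − 1 ≥ deg F`
      have hj₀ : J - n - 1 < J := by omega
      set j₀ : Fin J := ⟨J - n - 1, hj₀⟩ with hj₀def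
      have ht : J - n - 1 - F.natDegree < J := by omega
      set t : Fin J := ⟨J - n - 1 - F.natDegree, ht⟩ with htdef
      set c : M := (y - aeval (shiftEnd M J) F a) j₀ with hc
      refine ⟨a + Pi.single t c, fun j hj hjn => ?_⟩
      rw [map_add, ← sub_sub, Pi.sub_apply, aeval_shiftEnd_single_apply]
      by_cases hjeq : (j : ℕ) = J - n - 1
      · -- the new coordinate is cleared: leading coefficient `1`
        have hjj₀ : j = j₀ := Fin.ext hjeq
        rw [if_pos (by simp [htdef]; omega), show (j : ℕ) - t = F.natDegree by simp [htdef]; omega,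
          hF.coeff_natDegree, one_smul, hjj₀, ← hc, sub_self]
      · -- higher coordinates are untouched: `F` has no coefficient above its degree
        have hjgt : J ≤ (j : ℕ) + n := by omega
        rw [ha j hj hjgt]
        split_ifs with hle
        · rw [coeff_eq_zero_of_natDegree_lt (by simp [htdef] at hle ⊢; omega), zero_smul, sub_zero]
        · rw [sub_zero]
    · -- nothing new to clear
      refine ⟨a, fun j hj hjn => ha j hj (by omega)⟩

/-- **Division with remainder by a monic `F` on `Fin J → M`**: every `y` is `F(S)·a + r` with `r` supported in
coordinates `< deg F`. [cite: Washington1997, §7.1–§7.2] -/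
theorem exists_aeval_add_eq_of_monic (hF : F.Monic) (y : Fin J → M) :
    ∃ a r : Fin J → M, y = aeval (shiftEnd M J) F a + r ∧ ∀ j : Fin J, F.natDegree ≤ (j : ℕ) → r j = 0 := by
  obtain ⟨a, ha⟩ := exists_aeval_sub_apply_eq_zero_of_monic hF y J
  exact ⟨a, y - aeval (shiftEnd M J) F a, (add_sub_cancel _ _).symm, fun j hj => ha j hj (by omega)⟩

end Division

/-! ## §3 `#ker F(S) ≤ #M^{deg F}` -/

section Card

variable {M : Type*} [AddCommGroup M] [Finite M] {J : ℕ}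

/-- For an endomorphism `f` of a finite additive group, `#ker f · #range f = #G`. [folklore] -/
theorem natCard_ker_mul_natCard_range {G : Type*} [AddCommGroup G] [Finite G] (f : G →+ G) :
    Nat.card f.ker * Nat.card f.range = Nat.card G := by
  rw [mul_comm, ← Nat.card_congr (QuotientAddGroup.quotientKerEquivRange f).toEquiv]
  exact (AddSubgroup.card_eq_card_quotient_mul_card_addSubgroup f.ker).symm

/-- The vectors supported in coordinates `< d` number at most `#M^d`. [folklore] -/
theorem natCard_supported_le (d : ℕ) :
    Nat.card {r : Fin J → M // ∀ j : Fin J, d ≤ (j : ℕ) → r j = 0} ≤ Nat.card M ^ d := by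
  classical
  haveI : Fintype M := Fintype.ofFinite M
  let ι : {r : Fin J → M // ∀ j : Fin J, d ≤ (j : ℕ) → r j = 0} → (Fin d → M) :=
    fun r i => if h : (i : ℕ) < J then r.1 ⟨i, h⟩ else 0
  have hι : Function.Injective ι := by
    intro r r' h
    apply Subtype.ext
    funext j
    by_cases hjd : (j : ℕ) < d
    · have := congrFun h ⟨j, hjd⟩
      simpa [ι, j.2] using this
    · rw [r.2 j (not_lt.1 hjd), r'.2 j (not_lt.1 hjd)]
  calc Nat.card {r : Fin J → M // ∀ j : Fin J, d ≤ (j : ℕ) → r j = 0}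
      ≤ Nat.card (Fin d → M) := Nat.card_le_card_of_injective ι hι
    _ = Nat.card M ^ d := by rw [Nat.card_pi, Finset.prod_const, Finset.card_univ, Fintype.card_fin]

/-- **`#ker F(S) ≤ #M^{deg F}` for a monic `F`** on `Fin J → M`, `M` finite: `#ker = #coker` for an endomorphism of
a finite group, and the remainders of §2 surject onto the cokernel. [cite: Washington1997, §7.1–§7.2] -/
theorem natCard_ker_aeval_shiftEnd_le_of_monic {F : ℤ[X]} (hF : F.Monic) :
    Nat.card (LinearMap.ker (aeval (shiftEnd M J) F)) ≤ Nat.card M ^ F.natDegree := by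
  classical
  set f : (Fin J → M) →+ (Fin J → M) := (aeval (shiftEnd M J) F).toAddMonoidHom with hf
  have hker : Nat.card (LinearMap.ker (aeval (shiftEnd M J) F)) = Nat.card f.ker := rfl
  -- `range f × remainders ↠ Fin J → M`
  let R := {r : Fin J → M // ∀ j : Fin J, F.natDegree ≤ (j : ℕ) → r j = 0}
  let σ : f.range × R → (Fin J → M) := fun zr => (zr.1 : Fin J → M) + zr.2.1
  have hσ : Function.Surjective σ := by
    intro y
    obtain ⟨a, r, hy, hr⟩ := exists_aeval_add_eq_of_monic hF y
    exact ⟨(⟨f a, ⟨a, rfl⟩⟩, ⟨r, hr⟩), hy.symm⟩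
  have h1 : Nat.card (Fin J → M) ≤ Nat.card f.range * Nat.card R := by
    rw [← Nat.card_prod]
    exact Nat.card_le_card_of_surjective σ hσ
  have h2 := natCard_ker_mul_natCard_range f
  have hRle : Nat.card R ≤ Nat.card M ^ F.natDegree := natCard_supported_le F.natDegree
  have hrange_pos : 0 < Nat.card f.range := Nat.card_pos
  rw [hker]
  by_contra hlt
  rw [not_le] at hlt
  have : Nat.card (Fin J → M) < Nat.card f.ker * Nat.card f.range :=
    calc Nat.card (Fin J → M) ≤ Nat.card f.range * Nat.card R := h1
      _ ≤ Nat.card f.range * Nat.card M ^ F.natDegree := Nat.mul_le_mul_left _ hRle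
      _ < Nat.card f.range * Nat.card f.ker := Nat.mul_lt_mul_of_pos_left hlt hrange_pos
      _ = Nat.card f.ker * Nat.card f.range := mul_comm _ _
  omega

end Card

/-! ## §4 `ker ω(S) = range g(S)` from `g·ω ≡ X^J (mod p^k)` -/

section KerRange

variable {M : Type*} [AddCommGroup M] [Finite M] {J : ℕ} {n : ℕ}

/-- **`ker ω(S) = g(S)·𝒯_J`** on `𝒯_J = Fin J → M` (`n • M = 0`, `M` finite) for monic `ω`, `g` with
`deg ω + deg g = J` and `g·ω ≡ X^J` coefficientwise modulo `n` in degrees `< J`.  Proof: `ω(S)g(S) = X^J(S) = 0`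
gives `⊇`; `#ker ω(S) ≤ #M^{deg ω}` and `#range g(S) = #𝒯_J/#ker g(S) ≥ #M^J/#M^{deg g} = #M^{deg ω}` (§3) give
equality.  Used with `n = p^k`, `J = 2p^m k`, `ω = (X+1)^{p^m} − 1`, `g = m_ω·ω`: the TRANSVERSE VALUE MODULE of
the level-`p^k` local twist at an `E`-split prime of depth `m`. [cite: Washington1997, §7.1–§7.2]
[cite: MazurRubin2004, Lemma 1.2.1 and §5.3] -/
theorem ker_aeval_eq_range_aeval_of_monic_of_rel (hM : ∀ x : M, n • x = 0) {ω g : ℤ[X]} (hω : ω.Monic)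
    (hg : g.Monic) (hdeg : ω.natDegree + g.natDegree = J)
    (hrel : ∀ i, i < J → (n : ℤ) ∣ (g * ω - X ^ J).coeff i) :
    LinearMap.ker (aeval (shiftEnd M J) ω) = LinearMap.range (aeval (shiftEnd M J) g) := by
  classical
  -- `⊇`
  have hle : LinearMap.range (aeval (shiftEnd M J) g) ≤ LinearMap.ker (aeval (shiftEnd M J) ω) := by
    rintro _ ⟨a, rfl⟩
    rw [LinearMap.mem_ker, ← Module.End.mul_apply, ← map_mul, mul_comm,
      aeval_shiftEnd_apply_eq_of_forall_dvd_coeff_sub hM (g * ω) (X ^ J) hrel a, map_pow, aeval_X,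
      shiftEnd_pow_eq_zero le_rfl, LinearMap.zero_apply]
  -- cardinalities
  haveI : Fintype M := Fintype.ofFinite M
  have hT : Nat.card (Fin J → M) = Nat.card M ^ J := by
    rw [Nat.card_pi, Finset.prod_const, Finset.card_univ, Fintype.card_fin]
  have hkω := natCard_ker_aeval_shiftEnd_le_of_monic (M := M) (J := J) hω
  have hkg := natCard_ker_aeval_shiftEnd_le_of_monic (M := M) (J := J) hg
  set kg := Nat.card (LinearMap.ker (aeval (shiftEnd M J) g)) with hkgdef
  set rg := Nat.card (LinearMap.range (aeval (shiftEnd M J) g)) with hrgdef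
  have hprod : kg * rg = Nat.card M ^ g.natDegree * Nat.card M ^ ω.natDegree := by
    have h := natCard_ker_mul_natCard_range (aeval (shiftEnd M J) g).toAddMonoidHom
    have hJ' : Nat.card M ^ J = Nat.card M ^ g.natDegree * Nat.card M ^ ω.natDegree := by
      rw [← hdeg, pow_add, mul_comm]
    rw [hT, hJ'] at h
    exact h
  -- `#range g(S) ≥ #M^{deg ω}`: `kg · rg = A · B` with `kg ≤ A`, all positive
  have hrange : Nat.card M ^ ω.natDegree ≤ rg := by
    by_contra hlt
    rw [not_le] at hlt
    have hkpos : 0 < kg := Nat.card_pos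
    have h1 : kg * rg < kg * Nat.card M ^ ω.natDegree := Nat.mul_lt_mul_of_pos_left hlt hkpos
    have h2 : kg * Nat.card M ^ ω.natDegree ≤ Nat.card M ^ g.natDegree * Nat.card M ^ ω.natDegree :=
      Nat.mul_le_mul_right _ hkg
    exact absurd (hprod.symm ▸ h1.trans_le h2) (lt_irrefl _)
  -- conclude by cardinality
  have hcard : Nat.card (LinearMap.ker (aeval (shiftEnd M J) ω)) ≤ rg := hkω.trans hrange
  have h := AddSubgroup.eq_of_le_of_card_ge
    (H := (LinearMap.range (aeval (shiftEnd M J) g)).toAddSubgroup)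
    (K := (LinearMap.ker (aeval (shiftEnd M J) ω)).toAddSubgroup) hle hcard
  exact ((Submodule.toAddSubgroup_inj _ _).mp h).symm

end KerRange

/-! ## §5 The `E`-split operator `(1+S)^{p^m u} − 1 = ω(S)·Q(S)` with `Q(S)` a unit (`p^k • M = 0`, `p ∤ u`) -/

section SplitOperator

variable {M : Type*} [AddCommGroup M] {J : ℕ} {p : ℕ} [Fact p.Prime] {k : ℕ}

/-- A natural number prime to `p` acts invertibly on `Fin J → M` when `p^k • M = 0`. [folklore] -/
theorem isUnit_natCast_end_of_not_dvd_pk (hM : ∀ x : M, p ^ k • x = 0) {u : ℕ} (hu : ¬ p ∣ u) :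
    IsUnit ((u : ℕ) : Module.End ℤ (Fin J → M)) := by
  have hp : p.Prime := Fact.out
  have hcop : Nat.Coprime u (p ^ k) :=
    (Nat.Coprime.pow_left k ((Nat.Prime.coprime_iff_not_dvd hp).2 hu)).symm
  obtain ⟨v, hv⟩ := Int.mod_coprime hcop
  obtain ⟨c, hc⟩ := Int.modEq_iff_dvd.1 hv.symm
  -- `hc : (u : ℤ) * v - 1 = ↑(p^k) * c`
  have hp0 : ((p : Module.End ℤ (Fin J → M))) ^ k = 0 := by
    rw [← Nat.cast_pow]
    exact natCast_moduleEnd_eq_zero_of_pow_smul hM dvd_rfl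
  have hone : ((u : ℕ) : Module.End ℤ (Fin J → M)) * ((v : ℤ) : Module.End ℤ (Fin J → M)) = 1 := by
    have h2 : ((u : ℤ) * v : ℤ) = 1 + ((p ^ k : ℕ) : ℤ) * c := by linarith
    have h3 : (((u : ℤ) * v : ℤ) : Module.End ℤ (Fin J → M)) = 1 := by
      rw [h2]; push_cast; rw [hp0, zero_mul, add_zero]
    rw [← h3]; push_cast; rfl
  have hone' : ((v : ℤ) : Module.End ℤ (Fin J → M)) * ((u : ℕ) : Module.End ℤ (Fin J → M)) = 1 := by
    rw [← (Nat.cast_commute u _).eq]; exact hone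
  exact isUnit_iff_exists.2 ⟨_, hone, hone'⟩

/-- **A polynomial in the shift whose constant coefficient acts invertibly is a unit**: `Q(S) = Q(0) + S·Q₁(S)` with
`S` nilpotent and commuting. [folklore] -/
theorem isUnit_aeval_shiftEnd_of_isUnit_coeff_zero (Q : ℤ[X])
    (hQ : IsUnit ((Q.coeff 0 : ℤ) : Module.End ℤ (Fin J → M))) : IsUnit (aeval (shiftEnd M J) Q) := by
  set S : Module.End ℤ (Fin J → M) := shiftEnd M J with hS
  have hdecomp : aeval S Q = ((Q.coeff 0 : ℤ) : Module.End ℤ (Fin J → M)) + S * aeval S Q.divX := by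
    conv_lhs => rw [← X_mul_divX_add Q]
    rw [map_add, map_mul, aeval_X, aeval_C, add_comm]
    rfl
  have hnil : IsNilpotent (S * aeval S Q.divX) := by
    refine (Summit.BirchSwinnertonDyer.BirchSwinnertonDyer.Rank1Residual.LocalSplitPrime.commute_aeval_self
      S Q.divX).isNilpotent_mul_right ⟨J, ?_⟩
    rw [hS]; exact shiftEnd_pow_eq_zero le_rfl
  rw [hdecomp]
  refine hnil.isUnit_add_left_of_commute hQ ?_
  exact ((Int.cast_commute (Q.coeff 0) S).mul_right
    (Int.cast_commute (Q.coeff 0) (aeval S Q.divX))).symm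

omit [Fact p.Prime] in
/-- **`(1+S)^{p^m u} − 1 = ω(S)·Q(S)`** with `ω = (X+1)^{p^m} − 1` and `Q = Σ_{j<u} ((X+1)^{p^m})^j` (`Q(0) = u`):
the action of `Fr − 1` on the local twist at an `E`-split Frobenius of depth `m` (`…Division.omega_mul_geom_sum`).
[cite: Washington1997, §13.2] [cite: MazurRubin2004, §5.3] -/
theorem unipotentPow_sub_one_eq_aeval_omega_mul (m u : ℕ) :
    unipotentPow M J (p ^ m * u) - 1 =
      aeval (shiftEnd M J) ((X + 1 : ℤ[X]) ^ p ^ m - 1) *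
        aeval (shiftEnd M J) (∑ j ∈ range u, ((X + 1 : ℤ[X]) ^ p ^ m) ^ j) := by
  rw [← map_mul,
    (Summit.BirchSwinnertonDyer.BirchSwinnertonDyer.Theorems.OneSidedTwistSqueezeX9KatoDivisibilityX9KolyvaginReciprocityPkDivision.omega_mul_geom_sum
      (p ^ m) u).1, map_sub, map_one, unipotentPow_eq_aeval]

/-- `Q(S)` is a unit on `Fin J → M` (`p^k • M = 0`, `p ∤ u`). [cite: Washington1997, §13.2] -/
theorem isUnit_aeval_geom_sum (hM : ∀ x : M, p ^ k • x = 0) (m : ℕ) {u : ℕ} (hu : ¬ p ∣ u) :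
    IsUnit (aeval (shiftEnd M J) (∑ j ∈ range u, ((X + 1 : ℤ[X]) ^ p ^ m) ^ j)) := by
  refine isUnit_aeval_shiftEnd_of_isUnit_coeff_zero _ ?_
  rw [(Summit.BirchSwinnertonDyer.BirchSwinnertonDyer.Theorems.OneSidedTwistSqueezeX9KatoDivisibilityX9KolyvaginReciprocityPkDivision.omega_mul_geom_sum
    (p ^ m) u).2, Int.cast_natCast]
  exact isUnit_natCast_end_of_not_dvd_pk hM hu

/-- Kernel bookkeeping: for commuting `A`, `V` with `V` a unit, `ker (A·V) = ker A`. [folklore] -/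
theorem ker_mul_eq_of_isUnit_of_commute {A V : Module.End ℤ (Fin J → M)} (hV : IsUnit V) (hAV : Commute A V) :
    LinearMap.ker (A * V) = LinearMap.ker A := by
  obtain ⟨Vu, rfl⟩ := hV
  ext x
  rw [LinearMap.mem_ker, LinearMap.mem_ker, hAV.eq, Module.End.mul_apply]
  constructor
  · intro h
    have := congrArg (↑Vu⁻¹ : Module.End ℤ (Fin J → M)) h
    rwa [map_zero, ← Module.End.mul_apply, Units.inv_mul, Module.End.one_apply] at this
  · intro h
    rw [h, map_zero]

/-- Range bookkeeping: for `V` a unit, `range (A·V) = range A`. [folklore] -/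
theorem range_mul_eq_of_isUnit {A V : Module.End ℤ (Fin J → M)} (hV : IsUnit V) :
    LinearMap.range (A * V) = LinearMap.range A := by
  obtain ⟨Vu, rfl⟩ := hV
  have hsurj : Function.Surjective (↑Vu : Module.End ℤ (Fin J → M)) := fun x =>
    ⟨(↑Vu⁻¹ : Module.End ℤ (Fin J → M)) x, by
      rw [← Module.End.mul_apply, Units.mul_inv, Module.End.one_apply]⟩
  rw [Module.End.mul_eq_comp, LinearMap.range_comp, LinearMap.range_eq_top.2 hsurj, Submodule.map_top]

/-- **Fixed points of the `E`-split operator are `ker ω(S)`**: `(1+S)^{p^m u} x = x ↔ ω(S) x = 0` (`p ∤ u`,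
`p^k • M = 0`). [cite: MazurRubin2004, Lemma 1.2.1 and §5.3] -/
theorem unipotentPow_apply_eq_self_iff_aeval_omega (hM : ∀ x : M, p ^ k • x = 0) (m : ℕ) {u : ℕ}
    (hu : ¬ p ∣ u) (x : Fin J → M) :
    unipotentPow M J (p ^ m * u) x = x ↔ aeval (shiftEnd M J) ((X + 1 : ℤ[X]) ^ p ^ m - 1) x = 0 := by
  have h1 : unipotentPow M J (p ^ m * u) x = x ↔ x ∈ LinearMap.ker (unipotentPow M J (p ^ m * u) - 1) := by
    rw [LinearMap.mem_ker, LinearMap.sub_apply, Module.End.one_apply, sub_eq_zero]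
  rw [h1, unipotentPow_sub_one_eq_aeval_omega_mul, ker_mul_eq_of_isUnit_of_commute (isUnit_aeval_geom_sum hM m hu)
    ((Commute.all _ _).map (aeval (shiftEnd M J) : ℤ[X] →ₐ[ℤ] Module.End ℤ (Fin J → M))), LinearMap.mem_ker]

/-- **The image of the `E`-split operator is `ω(S)·𝒯_J`**: `range ((1+S)^{p^m u} − 1) = range ω(S)` (`p ∤ u`,
`p^k • M = 0`). [cite: MazurRubin2004, Lemma 1.2.1 and §5.3] -/
theorem range_unipotentPow_sub_one_eq_range_aeval_omega (hM : ∀ x : M, p ^ k • x = 0) (m : ℕ) {u : ℕ}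
    (hu : ¬ p ∣ u) :
    LinearMap.range (unipotentPow M J (p ^ m * u) - 1) =
      LinearMap.range (aeval (shiftEnd M J) ((X + 1 : ℤ[X]) ^ p ^ m - 1)) := by
  rw [unipotentPow_sub_one_eq_aeval_omega_mul, range_mul_eq_of_isUnit (isUnit_aeval_geom_sum hM m hu)]

end SplitOperator

end Summit.BirchSwinnertonDyer.BirchSwinnertonDyer.Theorems.OneSidedTwistSqueezeX9KatoDivisibilityX9ReciprocityPkAnnihilator

end
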